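import Literature.NumberTheory.EllipticCurves.HidaOrdinaryCohomologyParabolic
import Literature.NumberTheory.EllipticCurves.EichlerShimuraRealInjectivityProofs
import Mathlib.Algebra.MvPolynomial.Funext
import HarnessLib

/-!
# The Eichler–Shimura cocycles of cusp forms inside the cocycle spaces: Hecke compatibility,
# linear independence of the family `(ES f, conj ES f)`, and parabolicity

Fifth file of the cohomological proof of the deep half of Hida's rank constancy (serving the
named fact `Literature.NumberTheory.EllipticCurves.hida_exists_congruent_ordinary_newform`).
For `f ∈ S_{n+2}(Γ₀(N))` the tree's period cocycle `c_f(γ)(u, v)` (`EichlerShimuraPeriods.periodFn`)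
is a homogeneous polynomial of degree `n` in `(u, v)`; its coefficient vector `esVec f γ`
(`evalVec_esVec`) is a cocycle in the sense of `HidaOrdinaryCohomologyCocycles.cocycles`
(`periodFn_mul`), linear in `f` (`es`), and **`es (T_p f) = U_p (es f)`** on the nose
(`es_heckeT`, the tree's `periodFn_heckeT`, Shimura (8.3.2)).  With the complex conjugate
cocycles `conj (es f)` (`mapCocycles conj`) we obtain, for a basis `(fᵢ)` of `S_{n+2}(Γ₀(N))`, the
family `esFamily = (es fᵢ, conj es fᵢ)`, which is

* **linearly independent** for even `n` (`linearIndependent_esFamily`): a relation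
  `es F + conj es G = 0` forces `re c_{F+G} = 0` and `re c_{i(F-G)} = 0`, hence `F + G = 0 = F - G`
  by the tree's real injectivity of the Eichler–Shimura map (`eq_zero_of_isReCoboundary`,
  Shimura Thm. 8.4);
* **`U_p`-stable with matrix `diag(T, T̄)`**, `T` the matrix of `T_p` on `S_{n+2}`
  (`heckeUZ_esFamily`), so that the characteristic polynomial of `U_p` on its span is
  `χ_{T_p} · conj χ_{T_p}` (`charpoly_esMatrix`);
* **parabolic**: `c_f(Q)(v) = 0` for every `Q ∈ Γ₀(N)` with integral eigenvector `v`
  (`periodFn_eq_zero_of_isEigenElt`): writing `Q = ± g T^w g⁻¹`, `v ∈ ℤ g e₀`, the transformation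
  law of the Eichler integral (`eichlerKernel_slash_sub_eq`) reduces `c_f(Q)(g e₀)` to
  `∫_τ^{τ+w} (f ∣ g) = 0`, the cusp function `f ∣ g` being `w`-periodic because
  `(f ∣ g) ∣ T^w = f ∣ (Q g) = f ∣ g`.  Consequently every cocycle in the span of `esFamily`
  vanishes, as a form, on the eigenvectors of the parabolic elements (`evalVec_eq_zero_of_mem_span`)
  — the cocycles of cusp forms restrict to zero on the parabolic subgroups (Shimura (8.1.4)).

Everything is proved; no named facts.

## References

* G. Shimura, *Introduction to the arithmetic theory of automorphic functions* (1971), §8.1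
  ((8.1.4)), §8.2 ((8.2.17)–(8.2.20)), Thm. 8.4, §8.3 ((8.3.2), Prop. 8.5). [Shimura1971]
* H. Hida, *Elementary Modular Iwasawa Theory*, World Scientific 2022, §4.2.6 (Eichler–Shimura
  isomorphism), §4.2.11. [Hida2022EMI]
-/

noncomputable section

open scoped MatrixGroups ModularForm ComplexConjugate
open CongruenceSubgroup Matrix Module Module.End Complex Function
open UpperHalfPlane hiding I

namespace Literature.NumberTheory.EllipticCurves.ModularForms.HidaCohomology

/-! ### Moment coordinates versus monomial coefficients -/

section Mom

variable (n : ℕ) {R : Type*} [CommRing R]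

/-- **From moment coordinates to monomial coefficients**: `ofMom x` is the coefficient vector of
the moment polynomial `momPoly n x` (`evalVec_ofMom`). [folklore] -/
def ofMom : (Fin (n + 1) → R) →ₗ[R] (Fin (n + 1) → R) where
  toFun x i := (n.choose i : R) * (-1) ^ (n - i) * x i
  map_add' x y := by funext i; simp only [Pi.add_apply]; ring
  map_smul' c x := by funext i; simp only [Pi.smul_apply, smul_eq_mul, RingHom.id_apply]; ring

/-- Unfolding `ofMom`. [folklore] -/
@[simp] theorem ofMom_apply (x : Fin (n + 1) → R) (i : Fin (n + 1)) :
    ofMom n x i = (n.choose i : R) * (-1) ^ (n - i) * x i := rfl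

/-- `evalVec n (ofMom x) = momPoly n x`. [folklore] -/
theorem evalVec_ofMom (x : Fin (n + 1) → R) (p : Fin 2 → R) :
    evalVec n (ofMom n x) p = momPoly n x p := by
  rw [evalVec, momPoly_apply]
  refine Finset.sum_congr rfl fun i _ ↦ ?_
  rw [ofMom_apply, neg_pow]
  ring

variable {n}

/-- `evalVec` of a difference. [folklore] -/
theorem evalVec_sub (a b : Fin (n + 1) → R) (p : Fin 2 → R) :
    evalVec n (a - b) p = evalVec n a p - evalVec n b p := by
  simp [evalVec, sub_mul, Finset.sum_sub_distrib]

/-- `evalVec` of a finite sum. [folklore] -/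
theorem evalVec_sum {ι : Type*} (s : Finset ι) (a : ι → Fin (n + 1) → R) (p : Fin 2 → R) :
    evalVec n (∑ i ∈ s, a i) p = ∑ i ∈ s, evalVec n (a i) p := by
  classical
  induction s using Finset.induction_on with
  | empty => simp
  | insert j s hj ih => rw [Finset.sum_insert hj, Finset.sum_insert hj, evalVec_add, ih]

/-- Homogeneity of a binary form in its argument: `F(t p) = tⁿ F(p)`. [folklore] -/
theorem evalVec_smul_arg (a : Fin (n + 1) → R) (t : R) (p : Fin 2 → R) :
    evalVec n a (t • p) = t ^ n * evalVec n a p := by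
  simp only [evalVec, Pi.smul_apply, smul_eq_mul, Finset.mul_sum]
  refine Finset.sum_congr rfl fun i _ ↦ ?_
  have hi : (i : ℕ) ≤ n := Nat.lt_succ_iff.mp i.isLt
  have : t ^ n = t ^ (n - i) * t ^ (i : ℕ) := by rw [← pow_add, Nat.sub_add_cancel hi]
  rw [this, mul_pow, mul_pow]
  ring

/-- A binary form at a point with vanishing second coordinate: `F(x, 0) = a₀ xⁿ`. [folklore] -/
theorem evalVec_of_apply_one_eq_zero (a : Fin (n + 1) → R) {p : Fin 2 → R} (hp : p 1 = 0) :
    evalVec n a p = a 0 * p 0 ^ n := by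
  rw [evalVec, Finset.sum_eq_single (0 : Fin (n + 1))]
  · simp
  · intro i _ hi
    have hi' : (i : ℕ) ≠ 0 := fun h ↦ hi (Fin.ext h)
    rw [hp, zero_pow hi', mul_zero]
  · exact fun h ↦ (h (Finset.mem_univ _)).elim

/-- **Two coefficient vectors with the same form (as a function) over an infinite domain are
equal.** [folklore] -/
theorem eq_of_evalVec_eq {K : Type*} [CommRing K] [IsDomain K] [Infinite K] {a b : Fin (n + 1) → K}
    (h : ∀ p, evalVec n a p = evalVec n b p) : a = b :=
  toPoly_injective (MvPolynomial.funext fun p ↦ by rw [← evalVec_eq_eval, ← evalVec_eq_eval, h])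

/-- Real part of a complex form at a real point. [folklore] -/
theorem re_evalVec_ofReal (a : Fin (n + 1) → ℂ) (p : Fin 2 → ℝ) :
    (evalVec n a (fun k ↦ (p k : ℂ))).re = evalVec n (fun i ↦ (a i).re) p := by
  rw [evalVec, evalVec, Complex.re_sum]
  refine Finset.sum_congr rfl fun i _ ↦ ?_
  rw [← Complex.ofReal_pow, ← Complex.ofReal_pow, mul_assoc, ← Complex.ofReal_mul,
    Complex.re_mul_ofReal, mul_assoc]

/-- A complex form with real coefficients takes real values at real points. [folklore] -/
theorem evalVec_ofReal (a : Fin (n + 1) → ℝ) (p : Fin 2 → ℝ) :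
    evalVec n (fun i ↦ (a i : ℂ)) (fun k ↦ (p k : ℂ)) = ((evalVec n a p : ℝ) : ℂ) := by
  have := map_evalVec Complex.ofRealHom a p
  rw [Complex.ofRealHom_eq_coe] at this
  exact this.symm

end Mom

/-! ### The Eichler–Shimura cocycle of a cusp form as a coefficient vector -/

section ES

variable {n : ℕ} {N : ℕ}

/-- The complexified matrix of `γ` in the two forms used by the tree and by `act`. [folklore] -/
theorem map_gmat_eq_icmat (γ : Gamma0 N) : (gmat γ).map (Int.castRingHom ℂ) = icmat (γ : SL(2, ℤ)) := rfl

/-- `zcmat M = M.map (Int.castRingHom ℂ)`. [folklore] -/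
theorem zcmat_eq_map (M : Matrix (Fin 2) (Fin 2) ℤ) : zcmat M = M.map (Int.castRingHom ℂ) := rfl

variable [NeZero N]

variable (n) in
/-- **The coefficient vector of the period cocycle** `c_f(γ)` of `f ∈ S_{n+2}(Γ₀(N))`:
`evalVec n (esVec f γ) p = periodFn n f γ p` (`evalVec_esVec`). [cite: Shimura1971, §8.2 (8.2.20)] -/
def esVec (f : CuspForm (Gamma0 N) (n + 2)) (γ : Gamma0 N) : Fin (n + 1) → ℂ :=
  ofMom n (momVec n (⇑f) UpperHalfPlane.I) -
    act n (gmat γ) (ofMom n (momVec n (⇑f) ((γ : SL(2, ℤ)) • UpperHalfPlane.I)))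

/-- **The coefficient vector evaluates to the period cocycle.** [cite: Shimura1971, §8.2 (8.2.20)] -/
theorem evalVec_esVec (f : CuspForm (Gamma0 N) (n + 2)) (γ : Gamma0 N) (p : Fin 2 → ℂ) :
    evalVec n (esVec n f γ) p = periodFn n f γ p := by
  rw [esVec, evalVec_sub, evalVec_act, evalVec_ofMom, evalVec_ofMom, map_gmat_eq_icmat,
    ← eichlerKernel_eq_momPoly, ← eichlerKernel_eq_momPoly, periodFn_eq_of_mem f γ p UpperHalfPlane.I]

/-- The coefficient vectors form a cocycle. [cite: Shimura1971, §8.2 p. 233] -/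
theorem esVec_mem (f : CuspForm (Gamma0 N) (n + 2)) : esVec n f ∈ cocycles n N ℂ := by
  rw [mem_cocycles_iff]
  intro γ δ
  apply eq_of_evalVec_eq
  intro p
  rw [evalVec_add, evalVec_act, evalVec_esVec, evalVec_esVec, evalVec_esVec, map_gmat_eq_icmat,
    periodFn_mul]

variable (n N) in
/-- **The Eichler–Shimura map into the cocycle space**, `f ↦ (coefficient vector of c_f)`.
[cite: Shimura1971, §8.2 (8.2.20)] -/
def es : CuspForm (Gamma0 N) (n + 2) →ₗ[ℂ] cocycles n N ℂ where
  toFun f := ⟨esVec n f, esVec_mem f⟩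
  map_add' f g := by
    apply Subtype.ext
    funext γ
    apply eq_of_evalVec_eq
    intro p
    change evalVec n (esVec n (f + g) γ) p = evalVec n (esVec n f γ + esVec n g γ) p
    rw [evalVec_add, evalVec_esVec, evalVec_esVec, evalVec_esVec, periodFn_add]
  map_smul' c f := by
    apply Subtype.ext
    funext γ
    apply eq_of_evalVec_eq
    intro p
    change evalVec n (esVec n (c • f) γ) p = evalVec n (c • esVec n f γ) p
    rw [evalVec_smul, evalVec_esVec, evalVec_esVec, periodFn_smul]

/-- Unfolding `es`. [folklore] -/
@[simp] theorem coe_es (f : CuspForm (Gamma0 N) (n + 2)) :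
    ((es n N f : cocycles n N ℂ) : Gamma0 N → Fin (n + 1) → ℂ) = esVec n f := rfl

/-- **`es (T_p f) = U_p (es f)`**: the Eichler–Shimura map intertwines the Hecke operator `T_p` on
cusp forms with `U_p` on cocycles, exactly. [cite: Shimura1971, §8.3 (8.3.2) and Prop. 8.5] -/
theorem es_heckeT {p : ℕ} [NeZero p] (hp : p.Prime) (f : CuspForm (Gamma0 N) (n + 2)) :
    es n N (heckeT (Gamma0 N) (n + 2) p f) = heckeUZ n N ℂ hp (es n N f) := by
  apply Subtype.ext
  funext γ
  apply eq_of_evalVec_eq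
  intro q
  change evalVec n (esVec n (heckeT (Gamma0 N) (n + 2) p f) γ) q =
    evalVec n (heckeU n N ℂ hp (esVec n f) γ) q
  rw [evalVec_esVec, periodFn_heckeT hp, heckeU_apply, evalVec_sum]
  refine Finset.sum_congr rfl fun i _ ↦ ?_
  rw [evalVec_act, evalVec_esVec, zcmat_eq_map]

/-- `es` is injective. [cite: Shimura1971, Thm. 8.4] -/
theorem es_injective : Function.Injective (es n N) := by
  intro f g h
  have key : ∀ (γ : Gamma0 N) (p : Fin 2 → ℂ), periodFn n (f - g) γ p = 0 := by
    intro γ p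
    have h' := congrArg (fun u : cocycles n N ℂ ↦ evalVec n ((u : Gamma0 N → Fin (n + 1) → ℂ) γ) p) h
    simp only [coe_es, evalVec_esVec] at h'
    rw [show f - g = f + (-1 : ℂ) • g by rw [neg_one_smul, sub_eq_add_neg], periodFn_add,
      periodFn_smul, h']
    ring
  exact sub_eq_zero.mp (eq_zero_of_forall_periodFn_eq_zero (f - g) key)

/-- Homogeneity of the period cocycle in its argument. [folklore] -/
theorem periodFn_smul_arg (f : CuspForm (Gamma0 N) (n + 2)) (γ : Gamma0 N) (t : ℂ) (p : Fin 2 → ℂ) :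
    periodFn n f γ (t • p) = t ^ n * periodFn n f γ p := by
  rw [← evalVec_esVec, ← evalVec_esVec, evalVec_smul_arg]

end ES

/-! ### The family `(es fᵢ, conj es fᵢ)`: linear independence and Hecke matrix -/

section Family

variable {n N : ℕ} [NeZero N] {d : ℕ}


omit [NeZero N] in
variable (n N) in
/-- Complex conjugation on cocycles. [folklore] -/
def conjZ : cocycles n N ℂ →+ cocycles n N ℂ := mapCocycles n N (starRingEnd ℂ)

omit [NeZero N] in
/-- Unfolding `conjZ`. [folklore] -/
@[simp] theorem conjZ_apply (u : cocycles n N ℂ) (γ : Gamma0 N) (i : Fin (n + 1)) :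
    (conjZ n N u : Gamma0 N → Fin (n + 1) → ℂ) γ i = conj ((u : Gamma0 N → Fin (n + 1) → ℂ) γ i) := rfl

/-- **The Eichler–Shimura family** of a basis `(fᵢ)` of `S_{n+2}(Γ₀(N))`: the cocycles `es fᵢ`
and their complex conjugates. [cite: Shimura1971, Thm. 8.4] -/
def esFamily (bS : Module.Basis (Fin d) ℂ (CuspForm (Gamma0 N) (n + 2))) :
    Fin d ⊕ Fin d → cocycles n N ℂ
  | Sum.inl i => es n N (bS i)
  | Sum.inr i => conjZ n N (es n N (bS i))

/-- `esFamily` on the first summand. [folklore] -/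
@[simp] theorem esFamily_inl (bS : Module.Basis (Fin d) ℂ (CuspForm (Gamma0 N) (n + 2))) (i : Fin d) :
    esFamily bS (Sum.inl i) = es n N (bS i) := rfl

/-- `esFamily` on the second summand. [folklore] -/
@[simp] theorem esFamily_inr (bS : Module.Basis (Fin d) ℂ (CuspForm (Gamma0 N) (n + 2))) (i : Fin d) :
    esFamily bS (Sum.inr i) = conjZ n N (es n N (bS i)) := rfl

/-- A cusp form whose periods have vanishing real parts at real points is `0` (the tree's real
injectivity with the trivial coboundary). [cite: Shimura1971, Thm. 8.4] -/
theorem eq_zero_of_re_periodFn_eq_zero (hn : Even n) (F : CuspForm (Gamma0 N) (n + 2))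
    (h : ∀ (γ : Gamma0 N) (p : Fin 2 → ℝ), (periodFn n F γ (fun k ↦ (p k : ℂ))).re = 0) : F = 0 :=
  eq_zero_of_isReCoboundary n hn F 0 fun γ p ↦ by rw [h, map_zero]; simp

/-- **Linear independence of the Eichler–Shimura family** (even `n`): a relation
`es F + conj es G = 0` gives `re c_{F+G} = 0 = re c_{i(F-G)}`, so `F = G = 0` by real injectivity.
[cite: Shimura1971, Thm. 8.4] -/
theorem linearIndependent_esFamily (hn : Even n)
    (bS : Module.Basis (Fin d) ℂ (CuspForm (Gamma0 N) (n + 2))) : LinearIndependent ℂ (esFamily bS) := by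
  rw [Fintype.linearIndependent_iff]
  intro g hg
  set F : CuspForm (Gamma0 N) (n + 2) := ∑ i, g (Sum.inl i) • bS i with hF
  set G : CuspForm (Gamma0 N) (n + 2) := ∑ i, conj (g (Sum.inr i)) • bS i with hG
  -- the relation reads `es F + conjZ (es G) = 0`
  have hrel : es n N F + conjZ n N (es n N G) = 0 := by
    rw [Fintype.sum_sum_type] at hg
    simp only [esFamily_inl, esFamily_inr] at hg
    rw [hF, hG, map_sum, map_sum (es n N), map_sum (conjZ n N)]
    simp only [map_smul, conjZ, mapCocycles_smul, starRingEnd_self_apply]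
    exact hg
  have hpt : ∀ γ i, esVec n F γ i = -conj (esVec n G γ i) := by
    intro γ i
    have := congrArg (fun u : cocycles n N ℂ ↦ (u : Gamma0 N → Fin (n + 1) → ℂ) γ i) hrel
    simp only [Submodule.coe_add, Pi.add_apply, coe_es, conjZ_apply, Submodule.coe_zero,
      Pi.zero_apply] at this
    exact eq_neg_of_add_eq_zero_left this
  -- `F + G = 0`
  have h1 : F + G = 0 := by
    refine eq_zero_of_re_periodFn_eq_zero hn _ fun γ p ↦ ?_
    rw [← evalVec_esVec, show esVec n (F + G) = esVec n F + esVec n G from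
      congrArg Subtype.val (map_add (es n N) F G), re_evalVec_ofReal]
    have : (fun i ↦ ((esVec n F + esVec n G) γ i).re) = 0 := by
      funext i
      rw [Pi.add_apply, Pi.add_apply, hpt, Pi.zero_apply, Complex.add_re, Complex.neg_re,
        Complex.conj_re, neg_add_cancel]
    rw [this, evalVec_zero]
  -- `I • (F - G) = 0`
  have h2 : (Complex.I : ℂ) • (F - G) = 0 := by
    refine eq_zero_of_re_periodFn_eq_zero hn _ fun γ p ↦ ?_
    rw [periodFn_smul, ← evalVec_esVec, show esVec n (F - G) = esVec n F - esVec n G from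
      congrArg Subtype.val (map_sub (es n N) F G)]
    have : (esVec n F - esVec n G) γ = fun i ↦ ((-(2 * (esVec n G γ i).re) : ℝ) : ℂ) := by
      funext i
      rw [Pi.sub_apply, Pi.sub_apply, hpt]
      apply Complex.ext
      · simp; ring
      · simp
    rw [this, evalVec_ofReal, Complex.I_mul_re, Complex.ofReal_im, neg_zero]
  have hFG : F - G = 0 := by
    rcases smul_eq_zero.mp h2 with h | h
    · exact absurd h Complex.I_ne_zero
    · exact h
  have hF0 : F = 0 := by
    have : F + F = 0 := by
      calc F + F = (F + G) + (F - G) := by abel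
        _ = 0 := by rw [h1, hFG, add_zero]
    rwa [← two_smul ℂ F, smul_eq_zero, or_iff_right (two_ne_zero)] at this
  have hG0 : G = 0 := by rwa [hF0, zero_add] at h1
  -- read off the coefficients
  have hli := Fintype.linearIndependent_iff.mp bS.linearIndependent
  intro x
  cases x with
  | inl i => exact hli _ (by rw [← hF]; exact hF0) i
  | inr i =>
    have := hli _ (by rw [← hG]; exact hG0) i
    exact (map_eq_zero_iff (starRingEnd ℂ) (RingHom.injective _)).mp this

variable {p : ℕ} [NeZero p] (hp : p.Prime)

/-- **The matrix of `U_p` on the Eichler–Shimura family is `diag(T, T̄)`**, `T` the matrix of the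
Hecke operator `T_p` on `S_{n+2}(Γ₀(N))` in the basis `(fᵢ)`. [cite: Shimura1971, §8.3 Prop. 8.5] -/
theorem heckeUZ_esFamily (bS : Module.Basis (Fin d) ℂ (CuspForm (Gamma0 N) (n + 2)))
    (x : Fin d ⊕ Fin d) :
    heckeUZ n N ℂ hp (esFamily bS x) =
      ∑ y, (Matrix.fromBlocks (LinearMap.toMatrix bS bS (heckeT (Gamma0 N) (n + 2) p)) 0 0
        ((LinearMap.toMatrix bS bS (heckeT (Gamma0 N) (n + 2) p)).map (starRingEnd ℂ))) y x •
          esFamily bS y := by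
  set T := LinearMap.toMatrix bS bS (heckeT (Gamma0 N) (n + 2) p) with hT
  have hTb : ∀ j, heckeT (Gamma0 N) (n + 2) p (bS j) = ∑ i, T i j • bS i := by
    intro j
    conv_lhs => rw [← bS.sum_repr (heckeT (Gamma0 N) (n + 2) p (bS j))]
    refine Finset.sum_congr rfl fun i _ ↦ ?_
    rw [hT, LinearMap.toMatrix_apply]
  rw [Fintype.sum_sum_type]
  cases x with
  | inl j =>
    simp only [esFamily_inl, esFamily_inr, Matrix.fromBlocks_apply₁₁, Matrix.fromBlocks_apply₂₁,
      Matrix.zero_apply, zero_smul, Finset.sum_const_zero, add_zero]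
    rw [← es_heckeT hp, hTb, map_sum]
    simp only [map_smul]
  | inr j =>
    simp only [esFamily_inl, esFamily_inr, Matrix.fromBlocks_apply₁₂, Matrix.fromBlocks_apply₂₂,
      Matrix.zero_apply, zero_smul, Finset.sum_const_zero, zero_add, Matrix.map_apply]
    rw [conjZ, ← mapCocycles_heckeUZ, ← es_heckeT hp, hTb, map_sum]
    have hfun : (fun x ↦ es n N (T x j • bS x)) = fun x ↦ T x j • es n N (bS x) :=
      funext fun x ↦ map_smul _ _ _
    rw [hfun]
    exact mapCocycles_sum_smul (starRingEnd ℂ) Finset.univ (fun x ↦ T x j) (fun x ↦ es n N (bS x))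

variable (n N p) in
/-- The `U_p`-matrix of the Eichler–Shimura family, reindexed by `Fin (d + d)`. [folklore] -/
def esMatrix (bS : Module.Basis (Fin d) ℂ (CuspForm (Gamma0 N) (n + 2))) :
    Matrix (Fin (d + d)) (Fin (d + d)) ℂ :=
  Matrix.reindex finSumFinEquiv finSumFinEquiv
    (Matrix.fromBlocks (LinearMap.toMatrix bS bS (heckeT (Gamma0 N) (n + 2) p)) 0 0
      ((LinearMap.toMatrix bS bS (heckeT (Gamma0 N) (n + 2) p)).map (starRingEnd ℂ)))

/-- **The Eichler–Shimura family reindexed by `Fin (d + d)`.** [folklore] -/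
def esFamily' (bS : Module.Basis (Fin d) ℂ (CuspForm (Gamma0 N) (n + 2))) :
    Fin (d + d) → cocycles n N ℂ :=
  esFamily bS ∘ finSumFinEquiv.symm

/-- Linear independence of the reindexed family. [cite: Shimura1971, Thm. 8.4] -/
theorem linearIndependent_esFamily' (hn : Even n)
    (bS : Module.Basis (Fin d) ℂ (CuspForm (Gamma0 N) (n + 2))) :
    LinearIndependent ℂ (esFamily' bS) :=
  (linearIndependent_esFamily hn bS).comp _ finSumFinEquiv.symm.injective

/-- The `U_p`-matrix of the reindexed family. [cite: Shimura1971, §8.3 Prop. 8.5] -/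
theorem heckeUZ_esFamily' (bS : Module.Basis (Fin d) ℂ (CuspForm (Gamma0 N) (n + 2)))
    (b : Fin (d + d)) :
    heckeUZ n N ℂ hp (esFamily' bS b) = ∑ a, esMatrix n N p bS a b • esFamily' bS a := by
  rw [esFamily', Function.comp_apply, heckeUZ_esFamily hp bS]
  simp only [esMatrix, Matrix.reindex_apply, Matrix.submatrix_apply, Function.comp_apply]
  exact (Equiv.sum_comp finSumFinEquiv.symm (fun y ↦ (Matrix.fromBlocks
    (LinearMap.toMatrix bS bS (heckeT (Gamma0 N) (n + 2) p)) 0 0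
    ((LinearMap.toMatrix bS bS (heckeT (Gamma0 N) (n + 2) p)).map (starRingEnd ℂ))) y
      (finSumFinEquiv.symm b) • esFamily bS y)).symm

/-- **The characteristic polynomial of the `U_p`-matrix of the Eichler–Shimura family is
`χ_{T_p} · conj χ_{T_p}`** (the finite-dimensionality instance is the tree's
`finiteDimensional_cuspForm_gamma0`). [folklore] -/
theorem charpoly_esMatrix [FiniteDimensional ℂ (CuspForm (Gamma0 N) (n + 2))]
    (bS : Module.Basis (Fin d) ℂ (CuspForm (Gamma0 N) (n + 2))) :
    (esMatrix n N p bS).charpoly =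
      (heckeT (Gamma0 N) (n + 2) p).charpoly * ((heckeT (Gamma0 N) (n + 2) p).charpoly).map (starRingEnd ℂ) := by
  rw [esMatrix, Matrix.charpoly_reindex, Matrix.charpoly_fromBlocks_zero₁₂, Matrix.charpoly_map,
    LinearMap.charpoly_toMatrix]

end Family

/-! ### Parabolicity: the period cocycle vanishes on the eigenvectors of parabolic elements -/

section Parabolic

variable {N : ℕ} {k : ℤ}

/-- `(f ∣ g) ∣ T^w = f ∣ g` when `g T^w g⁻¹ ∈ Γ₀(N)`. [folklore] -/
theorem slash_T_zpow_of_conj_mem (f : CuspForm (Gamma0 N) k) (g : SL(2, ℤ)) (w : ℤ)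
    (hmem : g * ModularGroup.T ^ w * g⁻¹ ∈ Gamma0 N) :
    (⇑f ∣[k] g) ∣[k] (ModularGroup.T ^ w) = ⇑f ∣[k] g := by
  have h1 : ⇑f ∣[k] (g * ModularGroup.T ^ w * g⁻¹) = ⇑f := by
    rw [ModularForm.SL_slash]
    exact SlashInvariantForm.slash_action_eqn f _
      (Subgroup.mem_map_of_mem (Matrix.SpecialLinearGroup.mapGL ℝ) hmem)
  calc (⇑f ∣[k] g) ∣[k] (ModularGroup.T ^ w)
      = ⇑f ∣[k] ((g * ModularGroup.T ^ w * g⁻¹) * g) := by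
        rw [← SlashAction.slash_mul]; congr 1; group
    _ = ⇑f ∣[k] g := by rw [SlashAction.slash_mul, h1]

/-- Hence `(f ∣ g) ∘ ofComplex` is `w`-periodic when `g T^w g⁻¹ ∈ Γ₀(N)`. [folklore] -/
theorem periodic_slash_of_conj_mem (f : CuspForm (Gamma0 N) k) (g : SL(2, ℤ)) (w : ℤ)
    (hmem : g * ModularGroup.T ^ w * g⁻¹ ∈ Gamma0 N) :
    Periodic ((⇑f ∣[k] g) ∘ ofComplex) (w : ℝ) := by
  intro z
  by_cases hz : 0 < z.im
  · have hz' : 0 < (z + (w : ℝ)).im := by simpa using hz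
    have hT : ModularGroup.T ^ w • ofComplex z = ofComplex (z + (w : ℝ)) := by
      ext1
      rw [ModularGroup.coe_T_zpow_smul_eq, ofComplex_apply_of_im_pos hz,
        ofComplex_apply_of_im_pos hz']
      simp
    have := congr_fun (slash_T_zpow_of_conj_mem f g w hmem) (ofComplex z)
    rw [ModularForm.SL_slash_apply, hT] at this
    simp only [Function.comp_apply]
    rw [← this]
    have hd : denom (ModularGroup.T ^ w : SL(2, ℤ)) (ofComplex z) = 1 := by
      rw [ModularGroup.denom_apply, ModularGroup.coe_T_zpow]
      simp
    rw [hd, _root_.one_zpow, mul_one]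
  · have hz' : (z + (w : ℝ)).im ≤ 0 := by simpa using hz
    simp only [Function.comp_apply, ofComplex_apply_eq_of_im_nonpos hz' (not_lt.mp hz)]

/-- A function with period `|w|` has period `w`. [folklore] -/
theorem periodic_of_periodic_abs {f : ℂ → ℂ} {w : ℝ} (h : Periodic f ((|w| : ℝ) : ℂ)) :
    Periodic f (w : ℂ) := by
  rcases abs_choice w with h' | h'
  · rwa [h'] at h
  · rw [h', Complex.ofReal_neg] at h
    simpa using h.neg

variable [NeZero N]

/-- For `w ≠ 0` with `g T^w g⁻¹ ∈ Γ₀(N)`, the translate `f ∣ g` is a cusp function of period `|w|`.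
[folklore] -/
theorem isCuspFunction_slash_abs (f : CuspForm (Gamma0 N) k) (g : SL(2, ℤ)) {w : ℤ} (hw : w ≠ 0)
    (hmem : g * ModularGroup.T ^ w * g⁻¹ ∈ Gamma0 N) : IsCuspFunction |(w : ℝ)| (⇑f ∣[k] g) where
  pos := abs_pos.mpr (by exact_mod_cast hw)
  periodic := by
    have hper := periodic_slash_of_conj_mem f g w hmem
    rcases abs_choice (w : ℝ) with h' | h'
    · rwa [h']
    · rw [h', Complex.ofReal_neg]; exact hper.neg
  mdifferentiable := (isCuspFunction_slash f g).mdifferentiable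
  isZeroAtImInfty := (isCuspFunction_slash f g).isZeroAtImInfty

variable {n : ℕ}

/-- The Eichler kernel at `e₀ = (1, 0)` is `(-1)ⁿ ∫_τ^{i∞} φ`. [folklore] -/
theorem eichlerKernel_e0 (φ : ℍ → ℂ) (τ : ℍ) :
    eichlerKernel n φ τ ![1, 0] = (-1) ^ n * eichlerPrimitive φ τ := by
  rw [eichlerKernel, Finset.sum_eq_single 0]
  · simp [mul_comm]
  · intro j _ hj0
    simp [zero_pow hj0]
  · intro h; simp at h

/-- The Eichler kernel is even in its argument for even `n`. [folklore] -/
theorem eichlerKernel_neg (hn : Even n) (φ : ℍ → ℂ) (τ : ℍ) (q : Fin 2 → ℂ) :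
    eichlerKernel n φ τ (-q) = eichlerKernel n φ τ q := by
  rw [eichlerKernel_eq_momPoly, eichlerKernel_eq_momPoly, show -q = (-1 : ℂ) • q by simp,
    momPoly_smul_right, hn.neg_one_pow, one_mul]

/-- `icmat (T^w) e₀ = e₀`. [folklore] -/
theorem icmat_T_zpow_mulVec_e0 (w : ℤ) : (icmat (ModularGroup.T ^ w)).mulVec ![1, 0] = ![1, 0] := by
  rw [icmat, ModularGroup.coe_T_zpow]
  funext j
  fin_cases j <;> simp [Matrix.mulVec, dotProduct, Fin.sum_univ_two]

/-- **The core computation**: for `g T^w g⁻¹ ∈ Γ₀(N)`, `w ≠ 0`,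
`∫_τ^{i∞} f (zv - u)ⁿ dz - ∫_{(gT^wg⁻¹)τ}^{i∞} f (zv - u)ⁿ dz = 0` at `(u, v) = g e₀`:
by the transformation law this is `± ∫_{τ₀}^{τ₀ + w} (f ∣ g) = 0`. [cite: Shimura1971, §8.1 (8.1.4) and §8.2 (8.2.19)] -/
theorem eichlerKernel_sub_eq_zero_of_conj_mem (f : CuspForm (Gamma0 N) (n + 2)) (g : SL(2, ℤ))
    {w : ℤ} (hw : w ≠ 0) (hmem : g * ModularGroup.T ^ w * g⁻¹ ∈ Gamma0 N) (τ : ℍ) :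
    eichlerKernel n ⇑f τ ((icmat g).mulVec ![1, 0]) -
      eichlerKernel n ⇑f ((g * ModularGroup.T ^ w * g⁻¹ : SL(2, ℤ)) • τ) ((icmat g).mulVec ![1, 0]) = 0 := by
  obtain ⟨τ₀, rfl⟩ : ∃ τ₀ : ℍ, τ = g • τ₀ := ⟨g⁻¹ • τ, by rw [smul_smul, mul_inv_cancel, one_smul]⟩
  have hQτ : (g * ModularGroup.T ^ w * g⁻¹ : SL(2, ℤ)) • g • τ₀ = g • (ModularGroup.T ^ w • τ₀) := by
    rw [smul_smul, smul_smul,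
      show (g * ModularGroup.T ^ w * g⁻¹ : SL(2, ℤ)) * g = g * ModularGroup.T ^ w by group]
  -- the transformation law for `f` and `f ∣ g`
  have hψ := isCuspFunction_slash f g
  have hD := (isCuspFunction_one f).eichlerKernel_slash_sub_eq (n := n) (det_coe_pos g) hψ ![1, 0] τ₀
    (ModularGroup.T ^ w • τ₀)
  rw [cmat_coe, ← ModularGroup.sl_moeb, ← ModularGroup.sl_moeb] at hD
  have hD' : eichlerKernel n (⇑f ∣[(n + 2 : ℤ)] g) τ₀ ![1, 0] -
      eichlerKernel n ⇑f (g • τ₀) ((icmat g).mulVec ![1, 0]) =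
      eichlerKernel n (⇑f ∣[(n + 2 : ℤ)] g) (ModularGroup.T ^ w • τ₀) ![1, 0] -
        eichlerKernel n ⇑f (g • (ModularGroup.T ^ w • τ₀)) ((icmat g).mulVec ![1, 0]) := hD
  rw [hQτ]
  -- `∫_{τ₀}^{i∞} (f|g) - ∫_{τ₀ + w}^{i∞} (f|g) = 0` by periodicity of the Eichler primitive
  have hE : eichlerPrimitive (⇑f ∣[(n + 2 : ℤ)] g) (ModularGroup.T ^ w • τ₀) =
      eichlerPrimitive (⇑f ∣[(n + 2 : ℤ)] g) τ₀ := by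
    have hper := periodic_of_periodic_abs
      ((isCuspFunction_slash_abs f g hw hmem).periodic_eichlerPrimitive)
    have h1 : ModularGroup.T ^ w • τ₀ = ofComplex ((τ₀ : ℂ) + (w : ℝ)) := by
      ext1
      rw [ModularGroup.coe_T_zpow_smul_eq, ofComplex_apply_of_im_pos (by simpa using τ₀.im_pos)]
      simp
    have h2 := hper (τ₀ : ℂ)
    simp only [Function.comp_apply, ofComplex_apply] at h2
    rw [h1, h2]
  rw [eichlerKernel_e0, eichlerKernel_e0, hE] at hD'
  linear_combination (-1 : ℂ) * hD'

/-- **The period cocycle of a cusp form vanishes on the integral eigenvectors of the parabolic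
elements of `Γ₀(N)`** (even weight): `c_f(Q)(v) = 0` whenever `Q v = ± v`, `Q ≠ ±1` — the
Eichler–Shimura classes of cusp forms are parabolic. [cite: Shimura1971, §8.1 (8.1.4) and §8.2 p. 233] -/
theorem periodFn_eq_zero_of_isEigenElt (hn : Even n) (f : CuspForm (Gamma0 N) (n + 2)) {Q : Gamma0 N}
    {v : Fin 2 → ℤ} (hQ : IsEigenElt Q v) : periodFn n f Q (fun j ↦ (v j : ℂ)) = 0 := by
  obtain ⟨g, w, c, hw, -, hv, hform⟩ := exists_conj_of_isEigenElt hQ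
  -- reduce to `v = col0 g = g e₀`
  set u : Fin 2 → ℂ := (icmat g).mulVec ![1, 0] with hu
  have hvu : (fun j ↦ (v j : ℂ)) = (c : ℂ) • u := by
    rw [hv, hu, ← mulVec_e0]
    funext j
    simp only [Pi.smul_apply, smul_eq_mul, icmat, Matrix.mulVec, dotProduct, Fin.sum_univ_two,
      Matrix.map_apply]
    push_cast
    ring
  rw [hvu, periodFn_smul_arg, periodFn_eq_of_mem f Q u UpperHalfPlane.I]
  have hmem : g * ModularGroup.T ^ w * g⁻¹ ∈ Gamma0 N := by
    rcases hform with h | h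
    · rw [← h]; exact Q.2
    · have : g * ModularGroup.T ^ w * g⁻¹ = -(Q : SL(2, ℤ)) := by rw [h, neg_neg]
      rw [this]
      have hneg1 : (-1 : SL(2, ℤ)) ∈ Gamma0 N := by rw [Gamma0_mem]; simp
      simpa using (Gamma0 N).mul_mem hneg1 Q.2
  have hPu : (icmat (g * ModularGroup.T ^ w * g⁻¹)).mulVec u = u := by
    have h : (g * ModularGroup.T ^ w * g⁻¹ : SL(2, ℤ)) * g = g * ModularGroup.T ^ w := by group
    rw [hu, Matrix.mulVec_mulVec, ← icmat_mul, h, icmat_mul, ← Matrix.mulVec_mulVec,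
      icmat_T_zpow_mulVec_e0]
  rcases hform with h | h
  · rw [h, hPu, eichlerKernel_sub_eq_zero_of_conj_mem f g hw hmem, mul_zero]
  · have hic : icmat (Q : SL(2, ℤ)) = -icmat (g * ModularGroup.T ^ w * g⁻¹) := by
      rw [h]
      ext i j
      simp [icmat]
    have hsm : (Q : SL(2, ℤ)) • UpperHalfPlane.I = (g * ModularGroup.T ^ w * g⁻¹) • UpperHalfPlane.I := by
      rw [h, ModularGroup.SL_neg_smul]
    rw [hic, Matrix.neg_mulVec, hPu, eichlerKernel_neg hn, hsm,
      eichlerKernel_sub_eq_zero_of_conj_mem f g hw hmem, mul_zero]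

end Parabolic

/-! ### Every cocycle in the span of the Eichler–Shimura family is parabolic -/

section SpanParabolic

variable {n N : ℕ} [NeZero N] {d : ℕ}

omit [NeZero N] in
/-- Conjugating the coefficients conjugates the value at an integral point. [folklore] -/
theorem evalVec_conj (a : Fin (n + 1) → ℂ) (v : Fin 2 → ℤ) :
    evalVec n (fun i ↦ conj (a i)) (fun j ↦ (v j : ℂ)) = conj (evalVec n a (fun j ↦ (v j : ℂ))) := by
  rw [map_evalVec (starRingEnd ℂ)]
  congr 1
  funext j
  simp

/-- **Every cocycle in the span of the Eichler–Shimura family vanishes, as a form, on the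
integral eigenvectors of the parabolic elements** (even `n`). [cite: Shimura1971, §8.1 (8.1.4)] -/
theorem evalVec_eq_zero_of_mem_span (hn : Even n)
    (bS : Module.Basis (Fin d) ℂ (CuspForm (Gamma0 N) (n + 2))) {x : cocycles n N ℂ}
    (hx : x ∈ Submodule.span ℂ (Set.range (esFamily' bS))) {Q : Gamma0 N} {v : Fin 2 → ℤ}
    (hQ : IsEigenElt Q v) :
    evalVec n ((x : Gamma0 N → Fin (n + 1) → ℂ) Q) (fun j ↦ (v j : ℂ)) = 0 := by
  induction hx using Submodule.span_induction with
  | mem u hu =>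
    obtain ⟨a, rfl⟩ := hu
    rw [esFamily', Function.comp_apply]
    cases finSumFinEquiv.symm a with
    | inl i =>
      rw [esFamily_inl, coe_es, evalVec_esVec]
      exact periodFn_eq_zero_of_isEigenElt hn (bS i) hQ
    | inr i =>
      rw [esFamily_inr]
      change evalVec n (fun k ↦ conj (esVec n (bS i) Q k)) (fun j ↦ (v j : ℂ)) = 0
      rw [evalVec_conj, evalVec_esVec, periodFn_eq_zero_of_isEigenElt hn (bS i) hQ, map_zero]
  | zero => simp
  | add x y _ _ hx hy => rw [Submodule.coe_add, Pi.add_apply, evalVec_add, hx, hy, add_zero]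
  | smul c x _ hx => rw [Submodule.coe_smul, Pi.smul_apply, evalVec_smul, hx, mul_zero]

end SpanParabolic

end Literature.NumberTheory.EllipticCurves.ModularForms.HidaCohomology
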